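import Mathlib.Probability.Distributions.Gaussian.Multivariate
import Mathlib.Analysis.SpecialFunctions.Gaussian.GaussianIntegral
import Mathlib.Analysis.Matrix.Spectrum
import Mathlib.Analysis.Matrix.PosDef
import HarnessLib

/-!
# Uniform stability (2/3): dimension-free exponential moments of the squared norm of a centred Gaussian vector

Generic Gaussian calculus (no lattice objects), filed as a helper of crux `SourcedPressureIncrement`
(stmt-QuantumFields-22517; stub `stub_gauss`, cold-box child `ColdBoxSourcedPressure` stmt-QuantumFields-23807):

* `integral_exp_mul_sq_gaussianReal` — the χ² moment generating function: for `s < 1/2`,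
  `∫ exp(s x²) dN(0,1)(x) = √(1/(1 − 2s))` (and the integrand is integrable);
* `sqrt_one_div_one_sub_two_mul_le_exp` — `√(1/(1−2s)) ≤ exp(2s)` for `0 ≤ s ≤ 1/4`;
* `integral_exp_mul_sum_sq_pi_le` — for the product of standard Gaussians and weights `0 ≤ w_k` with `4 t w_k ≤ 1`,
  `t ≥ 0`: `∫ exp(t Σ_k w_k x_k²) ≤ exp(2t Σ_k w_k)` (Fubini, factor by factor);
* `integral_exp_mul_sum_sq_multivariateGaussian_le` — **for a centred Gaussian vector with covariance matrix `S`
  whose quadratic form is bounded by `Λ` (`vᵀSv ≤ Λ|v|²`) and `0 ≤ t`, `4tΛ ≤ 1`: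
  `E exp(t Σᵢ Xᵢ²) ≤ exp(2t · tr S)`**, integrand integrable — a bound that depends on the dimension ONLY through
  `tr S = E Σᵢ Xᵢ²` (spectral decomposition `S = Σ μ_k b_k b_kᵀ`, rotation invariance of the standard Gaussian
  `stdGaussian_eq_map_pi_orthonormalBasis`, and the two lemmas above with `w = μ`).

This is the volume-uniform STABILITY estimate `log E exp(t·Q) ≤ 2t·E Q` (`t ≤ 1/(4‖S‖)`) for nonnegative Gaussian
quadratic energies `Q`, the zeroth step of every cumulant / cluster expansion in a source coupled to `Q`.
Everything is proved; no definition, no named fact.  RECORD-label rung support; the Yang–Mills mass gap is NOT proved by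
anything here. [folklore]
-/

noncomputable section

open MeasureTheory ProbabilityTheory Real Matrix
open scoped RealInnerProductSpace NNReal MatrixOrder

namespace Summit.QuantumFields.YangMills.Cruxes.SourcedPressureIncrement.Birth

/-! ### One dimension: the χ² moment generating function -/

/-- The density computation behind the χ² mgf: `φ(x) · exp(s x²) = (2π)^{-1/2} exp(−(1/2 − s) x²)` for the standard
Gaussian density `φ`. [folklore] -/
theorem gaussianPDFReal_mul_exp_mul_sq (s x : ℝ) :
    gaussianPDFReal 0 1 x * Real.exp (s * x ^ 2) = (√(2 * π))⁻¹ * Real.exp (-(1 / 2 - s) * x ^ 2) := by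
  rw [gaussianPDFReal_def]
  simp only [NNReal.coe_one, mul_one, sub_zero]
  rw [mul_assoc, ← Real.exp_add]
  congr 2
  ring

/-- **χ² moment generating function.**  For `s < 1/2`: `exp(s x²)` is integrable for the standard Gaussian `N(0,1)` and
`∫ exp(s x²) dN(0,1) = √(1/(1 − 2s))`. [folklore] -/
theorem integral_exp_mul_sq_gaussianReal {s : ℝ} (hs : s < 1 / 2) :
    Integrable (fun x : ℝ => Real.exp (s * x ^ 2)) (gaussianReal 0 1) ∧
      ∫ x, Real.exp (s * x ^ 2) ∂gaussianReal 0 1 = √(1 / (1 - 2 * s)) := by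
  have hb : 0 < 1 / 2 - s := by linarith
  constructor
  · rw [gaussianReal_of_var_ne_zero 0 one_ne_zero,
      integrable_withDensity_iff_integrable_smul' (measurable_gaussianPDF 0 1)
        (ae_of_all _ fun _ => gaussianPDF_lt_top)]
    have h : (fun x : ℝ => (gaussianPDF 0 1 x).toReal • Real.exp (s * x ^ 2)) =
        fun x => (√(2 * π))⁻¹ * Real.exp (-(1 / 2 - s) * x ^ 2) := by
      funext x
      rw [toReal_gaussianPDF, smul_eq_mul, gaussianPDFReal_mul_exp_mul_sq]
    rw [h]
    exact (integrable_exp_neg_mul_sq hb).const_mul _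
  · rw [integral_gaussianReal_eq_integral_smul one_ne_zero]
    simp_rw [smul_eq_mul, gaussianPDFReal_mul_exp_mul_sq, integral_const_mul, integral_gaussian]
    have hπ : 0 < π := Real.pi_pos
    rw [← Real.sqrt_inv, ← Real.sqrt_mul (by positivity)]
    congr 1
    field_simp

/-- `√(1/(1 − 2s)) ≤ exp(2s)` for `0 ≤ s ≤ 1/4` (`(1 − 2s)(1 + 4s) ≥ 1` and `1 + 4s ≤ exp(4s)`). [folklore] -/
theorem sqrt_one_div_one_sub_two_mul_le_exp {s : ℝ} (hs0 : 0 ≤ s) (hs : s ≤ 1 / 4) :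
    √(1 / (1 - 2 * s)) ≤ Real.exp (2 * s) := by
  have h1 : 0 < 1 - 2 * s := by linarith
  have hexp : Real.exp (2 * s) ^ 2 = Real.exp (4 * s) := by
    rw [sq, ← Real.exp_add]; ring_nf
  have hkey : 1 / (1 - 2 * s) ≤ Real.exp (2 * s) ^ 2 := by
    rw [hexp, div_le_iff₀ h1]
    have h4 : 4 * s + 1 ≤ Real.exp (4 * s) := Real.add_one_le_exp _
    nlinarith [mul_nonneg hs0 (by linarith : (0 : ℝ) ≤ 1 / 4 - s)]
  calc √(1 / (1 - 2 * s)) ≤ √(Real.exp (2 * s) ^ 2) := Real.sqrt_le_sqrt hkey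
    _ = Real.exp (2 * s) := Real.sqrt_sq (Real.exp_pos _).le

/-- The 1-D bound: `∫ exp(s x²) dN(0,1) ≤ exp(2s)` for `0 ≤ s ≤ 1/4`. [folklore] -/
theorem integral_exp_mul_sq_gaussianReal_le {s : ℝ} (hs0 : 0 ≤ s) (hs : s ≤ 1 / 4) :
    ∫ x, Real.exp (s * x ^ 2) ∂gaussianReal 0 1 ≤ Real.exp (2 * s) := by
  rw [(integral_exp_mul_sq_gaussianReal (by linarith)).2]
  exact sqrt_one_div_one_sub_two_mul_le_exp hs0 hs

/-! ### Product of standard Gaussians -/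

/-- **Weighted sums of squares of independent standard Gaussians**: for `t ≥ 0` and weights `0 ≤ w_k` with
`4 t w_k ≤ 1`, `exp(t Σ_k w_k x_k²)` is integrable for `⊗_k N(0,1)` and `∫ exp(t Σ_k w_k x_k²) ≤ exp(2t Σ_k w_k)`
(Fubini and the 1-D bound). [folklore] -/
theorem integral_exp_mul_sum_sq_pi_le {κ : Type*} [Fintype κ] (w : κ → ℝ) {t : ℝ} (ht : 0 ≤ t)
    (hw0 : ∀ k, 0 ≤ w k) (hw : ∀ k, 4 * t * w k ≤ 1) :
    Integrable (fun x : κ → ℝ => Real.exp (t * ∑ k, w k * x k ^ 2)) (Measure.pi fun _ : κ => gaussianReal 0 1) ∧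
      ∫ x, Real.exp (t * ∑ k, w k * x k ^ 2) ∂(Measure.pi fun _ : κ => gaussianReal 0 1) ≤
        Real.exp (2 * t * ∑ k, w k) := by
  have hprod : (fun x : κ → ℝ => Real.exp (t * ∑ k, w k * x k ^ 2)) =
      fun x => ∏ k, Real.exp ((t * w k) * x k ^ 2) := by
    funext x
    rw [Finset.mul_sum, Real.exp_sum]
    refine Finset.prod_congr rfl fun k _ => ?_
    ring_nf
  have hs : ∀ k, t * w k < 1 / 2 := fun k => by nlinarith [hw k, hw0 k]
  rw [hprod]
  refine ⟨Integrable.fintype_prod (f := fun k (x : ℝ) => Real.exp ((t * w k) * x ^ 2))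
      fun k => (integral_exp_mul_sq_gaussianReal (hs k)).1, ?_⟩
  rw [integral_fintype_prod_eq_prod (f := fun k (x : ℝ) => Real.exp ((t * w k) * x ^ 2)),
    Finset.mul_sum, Real.exp_sum]
  refine Finset.prod_le_prod (fun k _ => integral_nonneg fun x => (Real.exp_pos _).le) fun k _ => ?_
  calc ∫ x, Real.exp (t * w k * x ^ 2) ∂gaussianReal 0 1 ≤ Real.exp (2 * (t * w k)) :=
        integral_exp_mul_sq_gaussianReal_le (mul_nonneg ht (hw0 k)) (by nlinarith [hw k])
    _ = Real.exp (2 * t * w k) := by ring_nf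

/-! ### Centred Gaussian vectors: rotation to the eigenbasis of the covariance -/

section Multivariate

variable {ι : Type*} [Fintype ι] [DecidableEq ι]

/-- For a positive semidefinite matrix `S` and `T = √S` (acting on Euclidean space): `‖T z‖² = ⟪z, S z⟫`. [folklore] -/
theorem norm_sq_sqrt_apply {S : Matrix ι ι ℝ} (hS : S.PosSemidef) (z : EuclideanSpace ℝ ι) :
    ‖toEuclideanCLM (𝕜 := ℝ) (CFC.sqrt S) z‖ ^ 2 = ⟪z, toEuclideanCLM (𝕜 := ℝ) S z⟫ := by
  have hT : IsSelfAdjoint (toEuclideanCLM (𝕜 := ℝ) (CFC.sqrt S)) := (CFC.sqrt_nonneg S).isSelfAdjoint.map _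
  rw [← real_inner_self_eq_norm_sq, ← ContinuousLinearMap.adjoint_inner_right, hT.adjoint_eq,
    ← ContinuousLinearMap.comp_apply, ← ContinuousLinearMap.mul_def, ← map_mul,
    CFC.sqrt_mul_sqrt_self _ hS.nonneg]

/-- The matrix acts diagonally on its eigenvector basis (as a map of Euclidean space). [folklore] -/
theorem toEuclideanCLM_eigenvectorBasis {S : Matrix ι ι ℝ} (hS : S.IsHermitian) (k : ι) :
    toEuclideanCLM (𝕜 := ℝ) S (hS.eigenvectorBasis k) = hS.eigenvalues k • hS.eigenvectorBasis k := by
  apply WithLp.ofLp_injective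
  rw [ofLp_toEuclideanCLM, WithLp.ofLp_smul, hS.mulVec_eigenvectorBasis k]

/-- In eigen-coordinates the quadratic form of `S` is diagonal: `⟪Σ x_k b_k, S (Σ x_k b_k)⟫ = Σ μ_k x_k²`. [folklore] -/
theorem inner_toEuclideanCLM_sum_eigenvectorBasis {S : Matrix ι ι ℝ} (hS : S.IsHermitian) (x : ι → ℝ) :
    ⟪∑ k, x k • hS.eigenvectorBasis k, toEuclideanCLM (𝕜 := ℝ) S (∑ k, x k • hS.eigenvectorBasis k)⟫ =
      ∑ k, hS.eigenvalues k * x k ^ 2 := by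
  have himg : toEuclideanCLM (𝕜 := ℝ) S (∑ k, x k • hS.eigenvectorBasis k) =
      ∑ k, (x k * hS.eigenvalues k) • hS.eigenvectorBasis k := by
    rw [map_sum]
    refine Finset.sum_congr rfl fun k _ => ?_
    rw [map_smul, toEuclideanCLM_eigenvectorBasis hS k, smul_smul]
  rw [himg, hS.eigenvectorBasis.orthonormal.inner_sum]
  refine Finset.sum_congr rfl fun k _ => ?_
  simp only [conj_trivial]
  ring

/-- Eigenvalues are bounded by any bound on the quadratic form: `vᵀSv ≤ Λ|v|²` for all `v` gives `μ_k ≤ Λ`. [folklore] -/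
theorem eigenvalues_le_of_dotProduct_mulVec_le {S : Matrix ι ι ℝ} (hS : S.IsHermitian) {Λ : ℝ}
    (hΛ : ∀ v : ι → ℝ, v ⬝ᵥ S *ᵥ v ≤ Λ * (v ⬝ᵥ v)) (k : ι) : hS.eigenvalues k ≤ Λ := by
  have h := hΛ (hS.eigenvectorBasis k)
  have hnorm : (hS.eigenvectorBasis k : EuclideanSpace ℝ ι) ⬝ᵥ (hS.eigenvectorBasis k : EuclideanSpace ℝ ι) = 1 := by
    have h1 : ⟪hS.eigenvectorBasis k, hS.eigenvectorBasis k⟫ = (1 : ℝ) := by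
      rw [real_inner_self_eq_norm_sq, hS.eigenvectorBasis.orthonormal.1 k, one_pow]
    rwa [EuclideanSpace.inner_eq_star_dotProduct, star_trivial] at h1
  rw [hS.mulVec_eigenvectorBasis k, dotProduct_smul, hnorm, smul_eq_mul, mul_one, mul_one] at h
  exact h

/-- **Dimension-free exponential moment of the squared norm of a centred Gaussian vector.**  Let `S` be a positive
semidefinite real matrix whose quadratic form is bounded by `Λ` (`vᵀ S v ≤ Λ Σ vᵢ²` for all `v`), and `0 ≤ t` with
`4 t Λ ≤ 1`.  Then under the centred Gaussian law with covariance matrix `S`, `exp(t Σᵢ yᵢ²)` is integrable and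
`∫ exp(t Σᵢ yᵢ²) d N(0,S)(y) ≤ exp(2 t · tr S)` — the constant involves the dimension only through `tr S = E Σᵢ yᵢ²`
(exact value `Π_k (1 − 2tμ_k)^{-1/2}` over the eigenvalues `μ_k` of `S`). [folklore] -/
theorem integral_exp_mul_sum_sq_multivariateGaussian_le {S : Matrix ι ι ℝ} (hS : S.PosSemidef) {Λ t : ℝ}
    (ht : 0 ≤ t) (hΛ : ∀ v : ι → ℝ, v ⬝ᵥ S *ᵥ v ≤ Λ * (v ⬝ᵥ v)) (htΛ : 4 * t * Λ ≤ 1) :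
    Integrable (fun y : EuclideanSpace ℝ ι => Real.exp (t * ∑ i, y i ^ 2)) (multivariateGaussian 0 S) ∧
      ∫ y, Real.exp (t * ∑ i, y i ^ 2) ∂multivariateGaussian 0 S ≤ Real.exp (2 * t * S.trace) := by
  set b := hS.1.eigenvectorBasis with hb
  set μ := hS.1.eigenvalues with hμ
  have hμ0 : ∀ k, 0 ≤ μ k := fun k => hS.eigenvalues_nonneg k
  have hμΛ : ∀ k, μ k ≤ Λ := fun k => eigenvalues_le_of_dotProduct_mulVec_le hS.1 hΛ k
  have hw : ∀ k, 4 * t * μ k ≤ 1 := fun k => by nlinarith [hμΛ k, hμ0 k]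
  obtain ⟨hint_pi, hle_pi⟩ := integral_exp_mul_sum_sq_pi_le μ ht hμ0 hw
  -- the integrand as a function of the norm, and its pull-backs
  set F : EuclideanSpace ℝ ι → ℝ := fun y => Real.exp (t * ∑ i, y i ^ 2) with hF
  have hFc : Continuous F := by
    simp only [hF]
    fun_prop
  set T := toEuclideanCLM (𝕜 := ℝ) (CFC.sqrt S) with hTdef
  set e : (ι → ℝ) → EuclideanSpace ℝ ι := fun x => ∑ k, x k • b k with he
  have hec : Continuous e := by
    simp only [he]
    fun_prop
  -- pointwise: F (T (e x)) = exp (t Σ μ_k x_k²)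
  have hpt : ∀ x : ι → ℝ, F (0 + T (e x)) = Real.exp (t * ∑ k, μ k * x k ^ 2) := by
    intro x
    simp only [hF, zero_add]
    congr 1
    rw [← EuclideanSpace.real_norm_sq_eq, hTdef, norm_sq_sqrt_apply hS, he, hb, hμ,
      inner_toEuclideanCLM_sum_eigenvectorBasis hS.1 x]
  -- the law: N(0,S) = T_* (e_* ⊗N(0,1))
  have hstd : stdGaussian (EuclideanSpace ℝ ι) = (Measure.pi fun _ : ι => gaussianReal 0 1).map e :=
    stdGaussian_eq_map_pi_orthonormalBasis b
  have hmvG : multivariateGaussian 0 S = ((Measure.pi fun _ : ι => gaussianReal 0 1).map e).map (fun z => 0 + T z) := by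
    rw [multivariateGaussian, hstd]
  have hmeasT : Measurable (fun z : EuclideanSpace ℝ ι => (0 : EuclideanSpace ℝ ι) + T z) := by fun_prop
  have hmease : Measurable e := hec.measurable
  -- integrability
  have hcomp : (fun x : ι → ℝ => F (0 + T (e x))) = fun x => Real.exp (t * ∑ k, μ k * x k ^ 2) := funext hpt
  have hcont2 : Continuous (fun z : EuclideanSpace ℝ ι => F (0 + T z)) := hFc.comp (by fun_prop)
  have hint1 : Integrable (fun z : EuclideanSpace ℝ ι => F (0 + T z)) ((Measure.pi fun _ : ι => gaussianReal 0 1).map e) := by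
    rw [integrable_map_measure hcont2.aestronglyMeasurable hmease.aemeasurable]
    show Integrable (fun x : ι → ℝ => F (0 + T (e x))) _
    rw [hcomp]; exact hint_pi
  refine ⟨?_, ?_⟩
  · rw [hmvG, integrable_map_measure hFc.aestronglyMeasurable hmeasT.aemeasurable]
    exact hint1
  · rw [hmvG, integral_map hmeasT.aemeasurable hFc.aestronglyMeasurable,
      integral_map hmease.aemeasurable hcont2.aestronglyMeasurable]
    show ∫ x : ι → ℝ, F (0 + T (e x)) ∂(Measure.pi fun _ : ι => gaussianReal 0 1) ≤ _
    rw [hcomp]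
    refine hle_pi.trans (le_of_eq ?_)
    congr 1
    rw [hS.1.trace_eq_sum_eigenvalues]
    simp [hμ]

end Multivariate

end Summit.QuantumFields.YangMills.Cruxes.SourcedPressureIncrement.Birth

end
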